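import Mathlib.FieldTheory.IsAlgClosed.AlgebraicClosure
import Literature.AnabelianGeometry.SemiGraphs.ArithmeticCurves
import HarnessLib

/-!
# The Example 5.6 tower record `StableReductionTower` is inhabited (degenerately), and why its arithmetic
# components are forced trivial over every `G_K = 1` model ([SemiAnbd] Ex. 5.6 p. 67)

Mochizuki, *Semi-graphs of anabelioids*, Publ. RIMS **42** (2006), §5 Example 5.6, manuscript p. 67: "an
exhaustive sequence of open characteristic subgroups of finite index … `⊆ M_i ⊆ … ⊆ Π`", "the arithmetic
semi-graphs of anabelioids `𝔊_i`, `𝔊^c_i`" with arithmetic fundamental groups "`M_i/N_i ⊆ Π/Δ = G_K`"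
[cite: MochizukiSemiAnbd2006, Ex 5.6 p.67].  Typed by abc-iut-L3-t3 as the INTERFACE record
`StableReductionTower 𝓥 D` over `D : TemperedArithmeticGroup K` plus the certificate structure
`StableReductionOrigin 𝓥 K` (`ArithmeticCurves.lean`).  The layer's inhabitation census
(INHABITATION-CENSUS-L3 v2, abc-iut-w4-d098) had `StableReductionTower` at 0 producers; abc-iut-w6-d055's
`OriginCertificatesNonVacuity.lean` (p432071) produced the ORIGIN certificates and recorded FINDING (F): no
honest tower producer at a genuine-arithmetic `D` (its `π̂₁(A_i)` would be an open subgroup of `G_{ℚ_p}`,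
whose Def 5.1 (i)(a) topological finite generation is GAP G-L4t4-2).

PROOF-ONLY file (abc-iut cell §4(iii) non-vacuity lane; seat abc-iut-L3-t7 gen 5; no `def`, no
`instance`, no named fact).  Kernel-checked here, and what it does NOT mean:

* `StableReductionTower.nonempty_mulEquiv_PA` / `….nonempty_mulEquiv_PAc` — FINDING (F) in the kernel:
  in EVERY tower `π̂₁(A_i) ≅ aug(M_i) ≤ G_K` (fields `injective_arithEmb`, `range_arithEmb`); hence
  `….subsingleton_PA_of_subsingleton`: over any `D` with trivial `G_K` (all the tree's `K̄`-models) every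
  level has TRIVIAL arithmetic component — a tower with non-trivial `π̂₁(A_i)` needs a `D` over a field
  with non-trivial `G_K` AND an exhaustive chain of open characteristic finite-index subgroups of its `Π`
  (for `Π ⊇ G_{ℚ_p}`: topological finite generation of `G_{ℚ_p}`, Jannsen–Wingberg / [NSW] 7.5.10 — not
  in the tree; recorded, not claimed).
* `StableReductionTower.nonempty_of_subsingleton` — the record IS inhabited over any `D` with trivial `Π`
  (e.g. `TemperedArithmeticGroup.exists_subsingleton_of_isAlgClosed`, the `K̄`-model of
  `TemperedCurvesWitness.lean` with its triviality exposed), GIVEN ONE connected arithmetic semi-graph of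
  anabelioids `𝔊 : ArithSemiGraph 𝓥` with `π̂₁(A) = 1` (the single remaining input; the `ArithSemiGraph`
  producer is the census's deferred row): constant tower `M_i := Π` (open, index 1, characteristic,
  exhaustive since `Π = 1`), `𝔊_i = 𝔊^c_i := 𝔊`, `admKer_i := 1`, decomposition representatives `⊤`
  with no abutments recorded, specialisation maps `inl`/`inr`.  DEGENERATE and labelled so: nothing
  here is the stable-reduction tower of a curve.
* `StableReductionTower.exists_of_arithSemiGraph` — outright `∃ D` over an algebraically closed field
  (same single input).  Certifying such a tower by a `StableReductionOrigin` is abc-iut-w6-d055's lane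
  (`OriginCertificatesNonVacuity.lean`: the certificate structures are uninterpreted, any datum admits a
  principal certificate) and is deliberately not done here.

INFO for the typer (not a defect of print): the incidence data `(E, edgeOf, abut)` of the fields
`dec i : DecompositionData …` are not tied by any field of `StableReductionTower` to the underlying
semi-graph `(𝓥.Edge (𝔊 i).G, 𝓥.Br, 𝓥.abut)`; the degenerate inhabitant uses `abut := none` throughout,
which the record permits.  Nothing here asserts a statement of [SemiAnbd]; instantiated ≠ endorsed;
nothing here bears on [IUTchIII] Cor. 3.12.
-/

noncomputable section

namespace Literature.AnabelianGeometry.SemiGraphs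

open _root_.CategoryTheory
open Literature.AlgebraicGeometry.Frobenioids (IsSlimGroup)

universe u v w u'

/-! ### Folklore helpers (trivial groups) -/

/-- Over an algebraically closed field the absolute Galois group is trivial. [folklore] -/
private theorem subsingleton_absGal_of_isAlgClosed (K : Type u') [Field K] [IsAlgClosed K] :
    Subsingleton (Field.absoluteGaloisGroup K) := by
  refine ⟨fun σ τ => AlgEquiv.ext fun x => ?_⟩
  obtain ⟨k, rfl⟩ :=
    (IsAlgClosed.algebraMap_bijective_of_isIntegral (k := K) (K := AlgebraicClosure K)).2 x
  rw [AlgEquiv.commutes, AlgEquiv.commutes]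

/-- A topological group with one element is tempered ([SemiAnbd] Def. 3.1 (i): all clauses trivial).
[folklore] -/
private theorem isTempered_of_subsingleton' (G : Type u') [Group G] [TopologicalSpace G]
    [Subsingleton G] : IsTempered G where
  basis U hU :=
    ⟨{ toOpenSubgroup := ⊤
       isNormal' := by change (⊤ : Subgroup G).Normal; infer_instance },
      inferInstance, fun g _ => by rw [Subsingleton.elim g 1]; exact mem_of_mem_nhds hU⟩
  separated g hg := absurd (Subsingleton.elim g 1) hg
  complete x _ := ⟨1, fun N => by
    obtain ⟨g, hg⟩ := QuotientGroup.mk_surjective (x N)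
    rw [← hg, Subsingleton.elim g 1]⟩

/-- A topological group with one element is slim. [folklore] -/
private theorem isSlimGroup_of_subsingleton' (G : Type u') [Group G] [TopologicalSpace G]
    [Subsingleton G] : IsSlimGroup G :=
  ⟨fun _ _ => Subsingleton.elim _ _⟩

/-- The degenerate tempered arithmetic group over an algebraically closed field: `Π := G_K = 1` with the
identity augmentation (as in `TemperedCurvesWitness.lean`, abc-iut-c312-4), here with its triviality
exposed. [cite: MochizukiSemiAnbd2006, Ex 3.10 pp.43-45] -/
theorem TemperedArithmeticGroup.exists_subsingleton_of_isAlgClosed (K : Type u') [Field K]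
    [IsAlgClosed K] : ∃ D : TemperedArithmeticGroup K, Subsingleton D.Pi := by
  haveI := subsingleton_absGal_of_isAlgClosed K
  haveI : Subsingleton (ContinuousMonoidHom.id (Field.absoluteGaloisGroup K)).toMonoidHom.ker :=
    inferInstance
  exact
    ⟨{ Pi := Field.absoluteGaloisGroup K
       isTempered := isTempered_of_subsingleton' _
       aug := ContinuousMonoidHom.id _
       aug_surjective := fun g => ⟨g, rfl⟩
       isTempered_ker := isTempered_of_subsingleton' _
       isSlimGroup := isSlimGroup_of_subsingleton' _
       isSlimGroup_ker := isSlimGroup_of_subsingleton' _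
       secondCountableTopology := inferInstance }, inferInstance⟩

/-! ### The Example 5.6 tower record `StableReductionTower` -/

namespace StableReductionTower

variable {Obj : Type u} [Category.{v} Obj] {𝓥 : SemiAnbdVocab.{u, v, w} Obj}
variable {K : Type u'} [Field K] {D : TemperedArithmeticGroup K}

/-- **Converse bookkeeping**: in any tower, the arithmetic component of level `i` is
`π̂₁(A_i) ≅ aug(M_i) ≤ G_K` (fields `injective_arithEmb`, `range_arithEmb`: "`π̂₁(A_i) ↪ G_K` … its image
is the image of `M_i` in `G_K`"). [cite: MochizukiSemiAnbd2006, Ex 5.6 p.67] -/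
theorem nonempty_mulEquiv_PA (T : StableReductionTower 𝓥 D) (i : ℕ) :
    Nonempty ((T.𝔊 i).PA ≃* ((T.M i).map D.aug.toMonoidHom)) :=
  ⟨(MonoidHom.ofInjective (T.injective_arithEmb i)).trans (MulEquiv.subgroupCongr (T.range_arithEmb i))⟩

/-- The same for the compact-structure levels `𝔊^c_i`. [cite: MochizukiSemiAnbd2006, Ex 5.6 p.67] -/
theorem nonempty_mulEquiv_PAc (T : StableReductionTower 𝓥 D) (i : ℕ) :
    Nonempty ((T.𝔊c i).PA ≃* ((T.M i).map D.aug.toMonoidHom)) :=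
  ⟨(MonoidHom.ofInjective (T.injective_arithEmbc i)).trans
    (MulEquiv.subgroupCongr (T.range_arithEmbc i))⟩

/-- Hence over any `D` whose `G_K` is trivial (all the tree's `K̄`-models) EVERY tower has trivial
arithmetic components `π̂₁(A_i) = 1`: the hypothesis of `nonempty_of_subsingleton` below is forced there.
[cite: MochizukiSemiAnbd2006, Ex 5.6 p.67] -/
theorem subsingleton_PA_of_subsingleton [Subsingleton (Field.absoluteGaloisGroup K)]
    (T : StableReductionTower 𝓥 D) (i : ℕ) : Subsingleton (T.𝔊 i).PA :=
  (T.injective_arithEmb i).subsingleton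

/-- **`StableReductionTower 𝓥 D` is inhabited** for `D` with trivial `Π` (hence trivial `G_K`), given a
connected arithmetic semi-graph of anabelioids `𝔊` over `𝓥` with trivial arithmetic fundamental group
`π̂₁(A) = 1`: constant tower `M_i := Π`, `𝔊_i = 𝔊^c_i := 𝔊`, trivial admissible kernels, decomposition
representatives `⊤` with no abutments recorded, identity specialisation maps.  DEGENERATE: every field of
the record holds for trivial reasons; nothing is a stable-reduction tower of a curve.
[cite: MochizukiSemiAnbd2006, Ex 5.6 p.67] -/
theorem nonempty_of_subsingleton (D : TemperedArithmeticGroup K) [Subsingleton D.Pi]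
    (𝔊 : ArithSemiGraph 𝓥) [Subsingleton (𝔊.PA : Type w)] :
    Nonempty (StableReductionTower 𝓥 D) := by
  classical
  haveI : Subsingleton (Field.absoluteGaloisGroup K) := D.aug_surjective.subsingleton
  haveI hSub : Subsingleton (Subgroup D.Pi) := Subgroup.subsingleton_iff.mpr inferInstance
  haveI hSubK : Subsingleton (Subgroup (Field.absoluteGaloisGroup K)) :=
    Subgroup.subsingleton_iff.mpr inferInstance
  -- the decomposition data at a level: representatives `⊤`, no abutments recorded
  let dec : DecompositionData (towerGroup (⊤ : Subgroup D.Pi) (⊥ : Subgroup D.Pi)) (𝓥.Vert 𝔊.G)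
      (Σ e : 𝓥.Edge 𝔊.G, 𝓥.Br e) :=
    { E := Σ e : 𝓥.Edge 𝔊.G, 𝓥.Br e
      edgeOf := id
      abut := fun _ => none
      vertGp := fun _ => ⊤
      brGp := fun _ => ⊤
      brGp_le_vertGp := fun _ _ _ => le_top }
  have hnormal : ((⊥ : Subgroup D.Pi).subgroupOf (⊤ : Subgroup D.Pi)).Normal := by
    rw [Subgroup.bot_subgroupOf]; infer_instance
  refine ⟨{ M := fun _ => ⊤
            isOpen_M := fun _ => by simp
            finiteIndex_M := fun _ => inferInstance
            characteristic_M := fun _ _ => Subsingleton.elim _ _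
            antitone_M := fun _ _ _ => le_rfl
            exhaustive_M := Subsingleton.elim _ _
            𝔊 := fun _ => 𝔊
            𝔊c := fun _ => 𝔊
            arithEmb := fun _ => 1
            continuous_arithEmb := fun _ => continuous_const
            injective_arithEmb := fun _ => Function.injective_of_subsingleton _
            range_arithEmb := fun _ => Subsingleton.elim _ _
            arithEmbc := fun _ => 1
            continuous_arithEmbc := fun _ => continuous_const
            injective_arithEmbc := fun _ => Function.injective_of_subsingleton _
            range_arithEmbc := fun _ => Subsingleton.elim _ _
            admKer := fun _ => ⊥
            admKer_le := fun _ => bot_le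
            admKer_normal := fun _ => hnormal
            admKer_mono := fun _ _ _ => le_rfl
            dec := fun _ => dec
            decc := fun _ => dec
            spV := fun _ _ _ v => Sum.inl v
            spE := fun _ _ _ e => Sum.inr e
            spVc := fun _ _ _ v => Sum.inl v
            spEc := fun _ _ _ e => Sum.inr e }⟩

/-- **Outright**: over an algebraically closed field, every connected arithmetic semi-graph of anabelioids
with trivial arithmetic fundamental group is the constant level of SOME Example 5.6 tower record (over the
degenerate `D` with `Π = G_K = 1`). [cite: MochizukiSemiAnbd2006, Ex 5.6 p.67] -/
theorem exists_of_arithSemiGraph (K : Type u') [Field K] [IsAlgClosed K] (𝔊 : ArithSemiGraph 𝓥)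
    [Subsingleton (𝔊.PA : Type w)] :
    ∃ D : TemperedArithmeticGroup K, Nonempty (StableReductionTower 𝓥 D) := by
  obtain ⟨D, hD⟩ := TemperedArithmeticGroup.exists_subsingleton_of_isAlgClosed K
  exact ⟨D, nonempty_of_subsingleton D 𝔊⟩

end StableReductionTower

end Literature.AnabelianGeometry.SemiGraphs

end
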